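import Summits.HodgeConjecture.HodgeConjecture.Theorems.F0LD1ThetaTransportKit
import Literature.NumberTheory.Automorphic.Liu2021.ThetaLiftFromLineFinIntertwiner
import HarnessLib

/-!
# Crux `HLiu418`, line LD2 (organ B₂) — KERNEL KIT, finite side (1∕2): the classes `[Θ̃_Φ(f) ∘ ιA]` ∕ `[Θ̃_{R_e E(Φ_∞ ⊗ Φ_f)}(f) ∘ ιA]` as LINEAR,
# EQUIVARIANT functions of the Schwartz–Bruhat datum, along an ABSTRACT adelic transport `ιA`
# (abstract-`ιA` twins of ★ `Liu2021.ThetaLiftFromLinePureTensor` §1–§2 and ★ `…CoinvariantJunction` §1)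

Cell hodgecm-mathlib (D-0151), FLOOR 0; crux item `HLiu418` = stmt-HodgeConjecture-24832; half-A line LD2 (socket `stub_S1b_facts`), organ B₂ `ThetaFinComponent₂`
(skeleton of LD2-plan (g0)).  Seat LD2-p02 (g0).  THEOREMS ONLY (no `def`, no instance, no notation, no named fact, no `sorry`); `--supports
stmt-HodgeConjecture-24832 --as helper`.  HC_CM is proved only modulo the 7 printed citations (2 remaining: hLiu418, h413) until rung 0 closes; this file
discharges nothing printed.

SETTING = ★ `F0LD1ThetaTransportKit` (LD1-p01 (g0)): ANY transport `ιA : U(H)(𝔸_{L⁺}) →* U(diag dV)(𝔸_{L⁺})` with `hιA : Continuous ιA ∧ (range toAdelic ↦ range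
toAdelic)`; the two finite-equivariance statements additionally take `hιAf : ιA (1, k) = (1, (ιA (1,k))_f)` («`ιA` carries finite-adelic elements to
finite-adelic elements» — for the PINNED transport of the LD organs this is ★ `F0LD2FrameTransportPin.pin_finAdelicToAdelic` + ★ `finPart_finAdelicToAdelic`,
with `(ιA (1,k))_f = (finAdelicCongr … g ht hg).symm k`).  Statements and proofs are the ★ ones with `cmAdelicFrameTransport L N H dV g hg ↦ ιA` (same
names, this namespace); rank-generic `N`.

* §1 (★ `PureTensor` §1–§2) `toQuotFun_lineThetaLift_smul_left ∕ _add_left`, `toLp_lineThetaLift_smul_left ∕ _add_left` — linearity of the class in `Φ`;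
  **`exists_tensor_of_apply_toLp_lineThetaLift_ne_zero`** — pure-tensor reduction (exact span, no continuity);
* §2 (★ `CoinvariantJunction` §1) `toLp_lineThetaLift_congr`, `toLp_lineThetaLift_tensor_smul ∕ _add`, **`rightRegular_finAdelicToAdelic_toLp_lineThetaLift_tensor`**
  (`U(H)(𝔸_f)`-equivariance, `ιV := finPart ∘ ιA ∘ (1, ·)`), **`toLp_lineThetaLift_tensor_finPairRep_one`** (`χ_W`-covariance);
(the finite theta intertwiner itself is file 2∕2, `F0LD2ThetaFinIntertwiner`).

## References
* [Liu2021] Y. Liu, Camb. J. Math. 9 (2021) = arXiv:2102.11518, proof of Prop. 4.13 Case 1 (l. 2131–2137, p. 48); Def. 4.11; App. D §D.1 Step 3 (l. 5221).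
* [Rallis1984] S. Rallis, Compositio Math. 51 (1984), proof of Thm. 1.2.2 p. 356.  [MoeglinVignerasWaldspurger1987] LNM 1291, Chap. 3 IV.
* [Weil1964] A. Weil, Acta Math. 111 (1964), Chap. III n° 37–38, n° 41 Thm 6.  [BorelJacquet1979] PSPM 33.1, §4.1, §4.6.
* [GelbartRogawski1991] S. Gelbart, J. Rogawski, Invent. Math. 105 (1991), §3.2 p. 457.  [FleigEtAl2018] CUP (2018), §12.3 Def. 12.5.
-/

set_option autoImplicit false
-- the mandated namespace has the single-problem summit's repeated segment (`HodgeConjecture.HodgeConjecture`)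
set_option linter.dupNamespace false

noncomputable section

open NumberField MeasureTheory IsDedekindDomain
open scoped Matrix Kronecker ComplexOrder ENNReal SchwartzMap TensorProduct Classical

namespace Summit.HodgeConjecture.HodgeConjecture.Cruxes.HLiu418.F0LD2ThetaTensorClasses

open _root_.MeasureTheory
open Literature.NumberTheory.Automorphic Literature.NumberTheory.Automorphic.UnitaryGroup
open Literature.NumberTheory.Automorphic.UnitaryGroup.CotangentForms
open Literature.NumberTheory.Automorphic.IdeleClassGroup
open Literature.NumberTheory.Automorphic.Liu2021
open Literature.NumberTheory.Automorphic.Liu2021.Def411WeilCarriers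
open Literature.NumberTheory.Automorphic.Liu2021.Def411WeilCarriersDoubling
open Literature.NumberTheory.GelbartRogawski1991 Literature.NumberTheory.GelbartRogawski1991.UnitaryDualPair
open Literature.NumberTheory.GelbartRogawski1991.UnitaryDualPair.WeilCoinv
open Literature.NumberTheory.Weil1964
open Literature.RepresentationTheory Literature.RepresentationTheory.Liu2021
open Literature.RepresentationTheory.CompactGroups
open Literature.RepresentationTheory.HeisenbergGroup
open Summit.HodgeConjecture.HodgeConjecture.Cruxes.HLiu418.F0LD1ThetaTransportKit

/-! ## §1 Linearity of the class in the Schwartz–Bruhat variable (★ `ThetaLiftFromLinePureTensor` §1) -/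

section Lift

variable (L : Type) [Field L] [NumberField L] [IsCMField L] (N : ℕ) (H : Matrix (Fin N) (Fin N) L)
  {n' : ℕ} (e₁ : Fin N × Fin 1 ≃ Fin n') (dV : Fin N → L) (hdV : ∀ i, IsCMField.complexConj L (dV i) = dV i)
  (hdV0 : ∀ i, dV i ≠ 0)
  (ιA : (adelicGroupData (↥(maximalRealSubfield L)) L (IsCMField.complexConj L) N H).Adelic →* ↥(UnitaryGroup.adelic (↥(maximalRealSubfield L)) L (IsCMField.complexConj L) N (Matrix.diagonal dV)))
  (hιA : Continuous ιA ∧ ∀ ⦃γ : (adelicGroupData (↥(maximalRealSubfield L)) L (IsCMField.complexConj L) N H).Adelic⦄,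
    γ ∈ (UnitaryGroup.toAdelic (↥(maximalRealSubfield L)) L (IsCMField.complexConj L) N H).range →
      ιA γ ∈ (UnitaryGroup.toAdelic (↥(maximalRealSubfield L)) L (IsCMField.complexConj L) N (Matrix.diagonal dV)).range)
  (μ : Literature.NumberTheory.Automorphic.IdeleClassGroup L →ₜ* Circle) (hμ : IsConjugateSymplectic L μ) (a : (↥(maximalRealSubfield L))ˣ)
  (hρ : HasThetaMajorants fun
      (p : ↥(UnitaryGroup.adelic (↥(maximalRealSubfield L)) L (IsCMField.complexConj L) N (Matrix.diagonal dV)) × ↥(UnitaryGroup.adelic (↥(maximalRealSubfield L)) L (IsCMField.complexConj L) 1 (JW (↥(maximalRealSubfield L)) L a))) (Φ : piSchwartzBruhat (↥(maximalRealSubfield L)) (Fin n')) =>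
        pairRep (↥(maximalRealSubfield L)) L (IsCMField.complexConj L) N 1 e₁ (Matrix.diagonal dV) (JW (↥(maximalRealSubfield L)) L a)
          (chiSplittingLine L e₁ dV hdV hdV0 (toHeckeCharacter L μ) (isUnitary_toHeckeCharacter L μ)
            ((isOscillatorChar_toHeckeCharacter_iff μ).mpr hμ) (TW (↥(maximalRealSubfield L)) a)
            (isUnit_det_TW (↥(maximalRealSubfield L)) a) (JW (↥(maximalRealSubfield L)) L a) (JW_eq (↥(maximalRealSubfield L)) L a))
          p Φ)
  [CompactSpace (↥(UnitaryGroup.adelic (↥(maximalRealSubfield L)) L (IsCMField.complexConj L) N (Matrix.diagonal dV)) ⧸ (UnitaryGroup.toAdelic (↥(maximalRealSubfield L)) L (IsCMField.complexConj L) N (Matrix.diagonal dV)).range)] [MeasurableSpace (↥(UnitaryGroup.adelic (↥(maximalRealSubfield L)) L (IsCMField.complexConj L) 1 (JW (↥(maximalRealSubfield L)) L a)) ⧸ (UnitaryGroup.toAdelic (↥(maximalRealSubfield L)) L (IsCMField.complexConj L) 1 (JW (↥(maximalRealSubfield L)) L a)).range)] (μW : Measure (↥(UnitaryGroup.adelic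 (↥(maximalRealSubfield L)) L (IsCMField.complexConj L) 1 (JW (↥(maximalRealSubfield L)) L a)) ⧸ (UnitaryGroup.toAdelic (↥(maximalRealSubfield L)) L (IsCMField.complexConj L) 1 (JW (↥(maximalRealSubfield L)) L a)).range))
  (f : C((↥(UnitaryGroup.adelic (↥(maximalRealSubfield L)) L (IsCMField.complexConj L) 1 (JW (↥(maximalRealSubfield L)) L a)) ⧸ (UnitaryGroup.toAdelic (↥(maximalRealSubfield L)) L (IsCMField.complexConj L) 1 (JW (↥(maximalRealSubfield L)) L a)).range), ℂ))

include hιA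

/-- **Homogeneity in the Schwartz–Bruhat variable**: `[x] ↦ Θ_{c•Φ}(f)([ιA x]) = c • Θ_Φ(f)([ιA x])` (★ `thetaLift_smul_left` for the
theta-linear datum ★ `lineThetaKernelDatum_thetaLinear`). [cite: Weil1964, Chap. III n° 41 Thm 6 p. 193]
[cite: FleigEtAl2018, §12.3 Def. 12.5 (12.37) p. 296] -/
theorem toQuotFun_lineThetaLift_smul_left (c : ℂ) (Φ : piSchwartzBruhat (↥(maximalRealSubfield L)) (Fin n')) :
    (toQuotFun (adelicGroupData (↥(maximalRealSubfield L)) L (IsCMField.complexConj L) N H) fun y => (lineThetaKernelDatum L N e₁ dV hdV hdV0 μ hμ a hρ).thetaLiftFun μW (c • Φ) f (ιA y)) =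
      c • toQuotFun (adelicGroupData (↥(maximalRealSubfield L)) L (IsCMField.complexConj L) N H) fun y => (lineThetaKernelDatum L N e₁ dV hdV hdV0 μ hμ a hρ).thetaLiftFun μW Φ f (ιA y) := by
  -- the generic lemma at `SX := 𝒮(𝔸^{n'})` with the theta-initial topology supplied explicitly (the `Module ℂ` instance of the type
  -- synonym `ThetaTop` is not found by instance synthesis through `AddCommGroup`; cf. ★ `cmThetaKernelDatum_line_thetaLift_cmPairRep_sub_smul_charCM`)
  have key : (lineThetaKernelDatum L N e₁ dV hdV hdV0 μ hμ a hρ).thetaLift μW (c • Φ) f =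
      c • (lineThetaKernelDatum L N e₁ dV hdV hdV0 μ hμ a hρ).thetaLift μW Φ f :=
    @ThetaKernelDatum.thetaLift_smul_left _ (↥(piSchwartzBruhat (↥(maximalRealSubfield L)) (Fin n'))) _ _
      (WeilThetaDatum.instTopologicalSpaceThetaTop _) _ _ _ _ _ _ _ _ _ _ (lineThetaKernelDatum L N e₁ dV hdV hdV0 μ hμ a hρ) _ _ _ _ μW
      (lineThetaKernelDatum_thetaLinear L N e₁ dV hdV hdV0 μ hμ a hρ) c Φ f
  funext q
  obtain ⟨x, rfl⟩ := QuotientGroup.mk_surjective q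
  simp only [Pi.smul_apply]
  rw [show (QuotientGroup.mk x : (adelicGroupData (↥(maximalRealSubfield L)) L (IsCMField.complexConj L) N H).automorphicQuotient) = (adelicGroupData (↥(maximalRealSubfield L)) L (IsCMField.complexConj L) N H).toAutomorphicQuotient x from rfl,
    toQuotFun_lineThetaLift_mk L N H e₁ dV hdV hdV0 ιA hιA μ hμ a hρ μW (c • Φ) f x, toQuotFun_lineThetaLift_mk L N H e₁ dV hdV hdV0 ιA hιA μ hμ a hρ μW Φ f x,
    key, ContinuousMap.smul_apply]

variable [BorelSpace (↥(UnitaryGroup.adelic (↥(maximalRealSubfield L)) L (IsCMField.complexConj L) 1 (JW (↥(maximalRealSubfield L)) L a)) ⧸ (UnitaryGroup.toAdelic (↥(maximalRealSubfield L)) L (IsCMField.complexConj L) 1 (JW (↥(maximalRealSubfield L)) L a)).range)] [IsFiniteMeasure μW]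

/-- **Additivity in the Schwartz–Bruhat variable**: `[x] ↦ Θ_{Φ₁+Φ₂}(f)([ιA x]) = Θ_{Φ₁}(f)([ιA x]) + Θ_{Φ₂}(f)([ιA x])` (★ `thetaLift_add_left`
for the theta-linear datum ★ `lineThetaKernelDatum_thetaLinear`). [cite: Weil1964, Chap. III n° 41 Thm 6 p. 193]
[cite: FleigEtAl2018, §12.3 Def. 12.5 (12.37) p. 296] -/
theorem toQuotFun_lineThetaLift_add_left (Φ₁ Φ₂ : piSchwartzBruhat (↥(maximalRealSubfield L)) (Fin n')) :
    (toQuotFun (adelicGroupData (↥(maximalRealSubfield L)) L (IsCMField.complexConj L) N H) fun y => (lineThetaKernelDatum L N e₁ dV hdV hdV0 μ hμ a hρ).thetaLiftFun μW (Φ₁ + Φ₂) f (ιA y)) =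
      (toQuotFun (adelicGroupData (↥(maximalRealSubfield L)) L (IsCMField.complexConj L) N H) fun y => (lineThetaKernelDatum L N e₁ dV hdV hdV0 μ hμ a hρ).thetaLiftFun μW Φ₁ f (ιA y)) + toQuotFun (adelicGroupData (↥(maximalRealSubfield L)) L (IsCMField.complexConj L) N H) fun y => (lineThetaKernelDatum L N e₁ dV hdV hdV0 μ hμ a hρ).thetaLiftFun μW Φ₂ f (ιA y) := by
  haveI := compactSpace_quotient_range_toAdelic_JW L a
  have key : (lineThetaKernelDatum L N e₁ dV hdV hdV0 μ hμ a hρ).thetaLift μW (Φ₁ + Φ₂) f =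
      (lineThetaKernelDatum L N e₁ dV hdV hdV0 μ hμ a hρ).thetaLift μW Φ₁ f + (lineThetaKernelDatum L N e₁ dV hdV hdV0 μ hμ a hρ).thetaLift μW Φ₂ f :=
    @ThetaKernelDatum.thetaLift_add_left _ (↥(piSchwartzBruhat (↥(maximalRealSubfield L)) (Fin n'))) _ _
      (WeilThetaDatum.instTopologicalSpaceThetaTop _) _ _ _ _ _ _ _ _ _ _ (lineThetaKernelDatum L N e₁ dV hdV hdV0 μ hμ a hρ) _ _ _ _ μW
      _ _ _ (lineThetaKernelDatum_thetaLinear L N e₁ dV hdV hdV0 μ hμ a hρ) Φ₁ Φ₂ f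
  funext q
  obtain ⟨x, rfl⟩ := QuotientGroup.mk_surjective q
  simp only [Pi.add_apply]
  rw [show (QuotientGroup.mk x : (adelicGroupData (↥(maximalRealSubfield L)) L (IsCMField.complexConj L) N H).automorphicQuotient) = (adelicGroupData (↥(maximalRealSubfield L)) L (IsCMField.complexConj L) N H).toAutomorphicQuotient x from rfl,
    toQuotFun_lineThetaLift_mk L N H e₁ dV hdV hdV0 ιA hιA μ hμ a hρ μW (Φ₁ + Φ₂) f x, toQuotFun_lineThetaLift_mk L N H e₁ dV hdV hdV0 ιA hιA μ hμ a hρ μW Φ₁ f x, toQuotFun_lineThetaLift_mk L N H e₁ dV hdV hdV0 ιA hιA μ hμ a hρ μW Φ₂ f x,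
    key, ContinuousMap.add_apply]

variable [CompactSpace (adelicGroupData (↥(maximalRealSubfield L)) L (IsCMField.complexConj L) N H).automorphicQuotient]
  (ν : Measure (adelicGroupData (↥(maximalRealSubfield L)) L (IsCMField.complexConj L) N H).automorphicQuotient) [IsFiniteMeasure ν]

omit [BorelSpace (↥(UnitaryGroup.adelic (↥(maximalRealSubfield L)) L (IsCMField.complexConj L) 1 (JW (↥(maximalRealSubfield L)) L a)) ⧸ (UnitaryGroup.toAdelic (↥(maximalRealSubfield L)) L (IsCMField.complexConj L) 1 (JW (↥(maximalRealSubfield L)) L a)).range)] [IsFiniteMeasure μW] in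
/-- **The `L²`-class is homogeneous in `Φ`**: `[Θ̃_{c•Φ}(f) ∘ ιA] = c • [Θ̃_Φ(f) ∘ ιA]` in `L²([U(H)], ν)`.
[cite: Weil1964, Chap. III n° 41 Thm 6 p. 193] -/
theorem toLp_lineThetaLift_smul_left (c : ℂ) (Φ : piSchwartzBruhat (↥(maximalRealSubfield L)) (Fin n')) :
    MemLp.toLp _ (memLp_toQuotFun_lineThetaLift L N H e₁ dV hdV hdV0 ιA hιA μ hμ a hρ μW (c • Φ) f ν 2) =
      c • MemLp.toLp _ (memLp_toQuotFun_lineThetaLift L N H e₁ dV hdV hdV0 ιA hιA μ hμ a hρ μW Φ f ν 2) := by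
  rw [← MemLp.toLp_const_smul]
  exact MemLp.toLp_congr _ _ (Filter.EventuallyEq.of_eq (toQuotFun_lineThetaLift_smul_left L N H e₁ dV hdV hdV0 ιA hιA μ hμ a hρ μW f c Φ))

/-- **The `L²`-class is additive in `Φ`**: `[Θ̃_{Φ₁+Φ₂}(f) ∘ ιA] = [Θ̃_{Φ₁}(f) ∘ ιA] + [Θ̃_{Φ₂}(f) ∘ ιA]` in `L²([U(H)], ν)`.
[cite: Weil1964, Chap. III n° 41 Thm 6 p. 193] -/
theorem toLp_lineThetaLift_add_left (Φ₁ Φ₂ : piSchwartzBruhat (↥(maximalRealSubfield L)) (Fin n')) :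
    MemLp.toLp _ (memLp_toQuotFun_lineThetaLift L N H e₁ dV hdV hdV0 ιA hιA μ hμ a hρ μW (Φ₁ + Φ₂) f ν 2) =
      MemLp.toLp _ (memLp_toQuotFun_lineThetaLift L N H e₁ dV hdV hdV0 ιA hιA μ hμ a hρ μW Φ₁ f ν 2) +
        MemLp.toLp _ (memLp_toQuotFun_lineThetaLift L N H e₁ dV hdV hdV0 ιA hιA μ hμ a hρ μW Φ₂ f ν 2) := by
  rw [← MemLp.toLp_add]
  exact MemLp.toLp_congr _ _ (Filter.EventuallyEq.of_eq (toQuotFun_lineThetaLift_add_left L N H e₁ dV hdV hdV0 ιA hιA μ hμ a hρ μW f Φ₁ Φ₂))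

/-- **PURE-TENSOR REDUCTION.**  If a `ℂ`-linear map `T` out of `L²([U(H)], ν)` does not kill the class `[Θ̃_Φ(f) ∘ ιA]` of SOME
Schwartz–Bruhat `Φ`, then it does not kill the class of some FACTORIZABLE `Φ_∞ ⊗ Φ_f` (`Φ_∞` a Schwartz function on `(L⁺ ⊗ ℝ)^{n′}`, `Φ_f`
Schwartz–Bruhat on `(𝔸_{L⁺}^∞)^{n′}`): the Schwartz–Bruhat space IS the span of the pure tensors (★ `piSchwartzBruhat`) and
`Φ ↦ T [Θ̃_Φ(f) ∘ ιA]` is linear (`toLp_lineThetaLift_add_left ∕ _smul_left`), so its zero set is a submodule — `Submodule.span_induction`.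
No continuity of `T` is needed (exact span). [cite: TateThesis1967, §3.2, §4.2] [cite: Weil1964, Chap. III n° 41 Thm 6 p. 193] -/
theorem exists_tensor_of_apply_toLp_lineThetaLift_ne_zero {X : Type*} [AddCommGroup X] [Module ℂ X] (T : Lp ℂ 2 ν →ₗ[ℂ] X)
    (Φ : piSchwartzBruhat (↥(maximalRealSubfield L)) (Fin n'))
    (hT : T (MemLp.toLp _ (memLp_toQuotFun_lineThetaLift L N H e₁ dV hdV hdV0 ιA hιA μ hμ a hρ μW Φ f ν 2)) ≠ 0) :
    ∃ (Φinf : 𝓢((Fin n' → NumberField.mixedEmbedding.mixedSpace ↥(maximalRealSubfield L)), ℂ))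
      (Φfin : (Fin n' → FiniteAdeleRing (𝓞 ↥(maximalRealSubfield L)) ↥(maximalRealSubfield L)) → ℂ)
      (hfin : Φfin ∈ SchwartzBruhat (Fin n' → FiniteAdeleRing (𝓞 ↥(maximalRealSubfield L)) ↥(maximalRealSubfield L))),
      T (MemLp.toLp _ (memLp_toQuotFun_lineThetaLift L N H e₁ dV hdV hdV0 ιA hιA μ hμ a hρ μW
        ⟨fun v => Φinf (piArch (↥(maximalRealSubfield L)) (Fin n') v) * Φfin (piFinite (↥(maximalRealSubfield L)) (Fin n') v),
          tensor_mem_piSchwartzBruhat Φinf hfin⟩ f ν 2)) ≠ 0 := by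
  by_contra hcon
  push Not at hcon
  -- the functional `Ψ ↦ T [Θ̃_Ψ(f) ∘ ιA]` on the Schwartz–Bruhat space
  let F : piSchwartzBruhat (↥(maximalRealSubfield L)) (Fin n') → X := fun Ψ =>
    T (MemLp.toLp _ (memLp_toQuotFun_lineThetaLift L N H e₁ dV hdV hdV0 ιA hιA μ hμ a hρ μW Ψ f ν 2))
  have hadd : ∀ Ψ₁ Ψ₂, F (Ψ₁ + Ψ₂) = F Ψ₁ + F Ψ₂ := fun Ψ₁ Ψ₂ => by
    simp only [F]
    rw [toLp_lineThetaLift_add_left L N H e₁ dV hdV hdV0 ιA hιA μ hμ a hρ μW f ν Ψ₁ Ψ₂, map_add]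
  have hsmul : ∀ (c : ℂ) Ψ, F (c • Ψ) = c • F Ψ := fun c Ψ => by
    simp only [F]
    rw [toLp_lineThetaLift_smul_left L N H e₁ dV hdV hdV0 ιA hιA μ hμ a hρ μW f ν c Ψ, map_smul]
  have key : ∀ (x : (Fin n' → AdeleRing (𝓞 ↥(maximalRealSubfield L)) ↥(maximalRealSubfield L)) → ℂ)
      (hx : x ∈ piSchwartzBruhat (↥(maximalRealSubfield L)) (Fin n')), F ⟨x, hx⟩ = 0 := by
    intro x hx
    induction hx using Submodule.span_induction with
    | mem x hx =>
        obtain ⟨Φinf, Φfin, hfin, rfl⟩ := hx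
        exact hcon Φinf Φfin hfin
    | zero =>
        have h0 : F 0 = 0 := by
          have h := hsmul 0 0
          rwa [zero_smul, zero_smul] at h
        exact h0
    | add x y hx hy ihx ihy =>
        change F (⟨x, hx⟩ + ⟨y, hy⟩) = 0
        rw [hadd, ihx, ihy, add_zero]
    | smul c x hx ih =>
        change F (c • ⟨x, hx⟩) = 0
        rw [hsmul, ih, smul_zero]
  exact hT (key Φ Φ.2)

end Lift

/-! ## §2 The class as a function of the finite factor (★ `ThetaLiftFromLineCoinvariantJunction` §1) -/

section Tensor

variable (L : Type) [Field L] [NumberField L] [IsCMField L] (N : ℕ) (H : Matrix (Fin N) (Fin N) L)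
  {n' : ℕ} (e₁ : Fin N × Fin 1 ≃ Fin n') (dV : Fin N → L) (hdV : ∀ i, IsCMField.complexConj L (dV i) = dV i)
  (hdV0 : ∀ i, dV i ≠ 0)
  (ιA : (adelicGroupData (↥(maximalRealSubfield L)) L (IsCMField.complexConj L) N H).Adelic →* ↥(UnitaryGroup.adelic (↥(maximalRealSubfield L)) L (IsCMField.complexConj L) N (Matrix.diagonal dV)))
  (hιA : Continuous ιA ∧ ∀ ⦃γ : (adelicGroupData (↥(maximalRealSubfield L)) L (IsCMField.complexConj L) N H).Adelic⦄,
    γ ∈ (UnitaryGroup.toAdelic (↥(maximalRealSubfield L)) L (IsCMField.complexConj L) N H).range →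
      ιA γ ∈ (UnitaryGroup.toAdelic (↥(maximalRealSubfield L)) L (IsCMField.complexConj L) N (Matrix.diagonal dV)).range)
  (μ : Literature.NumberTheory.Automorphic.IdeleClassGroup L →ₜ* Circle) (hμ : IsConjugateSymplectic L μ) (a : (↥(maximalRealSubfield L))ˣ)
  (hρ : HasThetaMajorants fun
      (p : ↥(UnitaryGroup.adelic (↥(maximalRealSubfield L)) L (IsCMField.complexConj L) N (Matrix.diagonal dV)) × ↥(UnitaryGroup.adelic (↥(maximalRealSubfield L)) L (IsCMField.complexConj L) 1 (JW (↥(maximalRealSubfield L)) L a))) (Φ : piSchwartzBruhat (↥(maximalRealSubfield L)) (Fin n')) =>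
        pairRep (↥(maximalRealSubfield L)) L (IsCMField.complexConj L) N 1 e₁ (Matrix.diagonal dV) (JW (↥(maximalRealSubfield L)) L a)
          (chiSplittingLine L e₁ dV hdV hdV0 (toHeckeCharacter L μ) (isUnitary_toHeckeCharacter L μ)
            ((isOscillatorChar_toHeckeCharacter_iff μ).mpr hμ) (TW (↥(maximalRealSubfield L)) a)
            (isUnit_det_TW (↥(maximalRealSubfield L)) a) (JW (↥(maximalRealSubfield L)) L a) (JW_eq (↥(maximalRealSubfield L)) L a))
          p Φ)
  [CompactSpace (↥(UnitaryGroup.adelic (↥(maximalRealSubfield L)) L (IsCMField.complexConj L) N (Matrix.diagonal dV)) ⧸ (UnitaryGroup.toAdelic (↥(maximalRealSubfield L)) L (IsCMField.complexConj L) N (Matrix.diagonal dV)).range)] [MeasurableSpace (↥(UnitaryGroup.adelic (↥(maximalRealSubfield L)) L (IsCMField.complexConj L) 1 (JW (↥(maximalRealSubfield L)) L a)) ⧸ (UnitaryGroup.toAdelic (↥(maximalRealSubfield L)) L (IsCMField.complexConj L) 1 (JW (↥(maximalRealSubfield L)) L a)).range)] (μW : Measure (↥(UnitaryGroup.adelic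 (↥(maximalRealSubfield L)) L (IsCMField.complexConj L) 1 (JW (↥(maximalRealSubfield L)) L a)) ⧸ (UnitaryGroup.toAdelic (↥(maximalRealSubfield L)) L (IsCMField.complexConj L) 1 (JW (↥(maximalRealSubfield L)) L a)).range))
  (f : C((↥(UnitaryGroup.adelic (↥(maximalRealSubfield L)) L (IsCMField.complexConj L) 1 (JW (↥(maximalRealSubfield L)) L a)) ⧸ (UnitaryGroup.toAdelic (↥(maximalRealSubfield L)) L (IsCMField.complexConj L) 1 (JW (↥(maximalRealSubfield L)) L a)).range), ℂ))
  (φ : 𝓢(((Fin N × Fin 1) → NumberField.mixedEmbedding.mixedSpace ↥(maximalRealSubfield L)), ℂ))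
  [CompactSpace (adelicGroupData (↥(maximalRealSubfield L)) L (IsCMField.complexConj L) N H).automorphicQuotient]
  (ν : Measure (adelicGroupData (↥(maximalRealSubfield L)) L (IsCMField.complexConj L) N H).automorphicQuotient) [IsFiniteMeasure ν]

include hιA

/-- congruence of the class `[Θ̃_Ψ(f) ∘ ιA]` in the Schwartz–Bruhat datum (bookkeeping for the proof-carrying `MemLp.toLp`).
[cite: FleigEtAl2018, §12.3 Def. 12.5 (12.37) p. 296] -/
theorem toLp_lineThetaLift_congr {Ψ₁ Ψ₂ : piSchwartzBruhat (↥(maximalRealSubfield L)) (Fin n')} (h : Ψ₁ = Ψ₂) :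
    MemLp.toLp _ (memLp_toQuotFun_lineThetaLift L N H e₁ dV hdV hdV0 ιA hιA μ hμ a hρ μW Ψ₁ f ν 2) =
      MemLp.toLp _ (memLp_toQuotFun_lineThetaLift L N H e₁ dV hdV hdV0 ιA hιA μ hμ a hρ μW Ψ₂ f ν 2) := by
  subst h; rfl

/-- **Homogeneity in the finite factor**: `[Θ̃_{R_e E(Φ_∞ ⊗ c•Φ_f)}(f) ∘ ιA] = c • [Θ̃_{R_e E(Φ_∞ ⊗ Φ_f)}(f) ∘ ιA]`.
[cite: Weil1964, Chap. III n° 41 Thm 6 p. 193] -/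
theorem toLp_lineThetaLift_tensor_smul (c : ℂ) (Φf : FinSB (↥(maximalRealSubfield L)) (Fin N × Fin 1)) :
    MemLp.toLp _ (memLp_toQuotFun_lineThetaLift L N H e₁ dV hdV hdV0 ιA hιA μ hμ a hρ μW
        (piSBReindex (↥(maximalRealSubfield L)) e₁ (piSchwartzBruhatEquiv (↥(maximalRealSubfield L)) (Fin N × Fin 1) (φ ⊗ₜ[ℂ] (c • Φf)))) f ν 2) =
      c • MemLp.toLp _ (memLp_toQuotFun_lineThetaLift L N H e₁ dV hdV hdV0 ιA hιA μ hμ a hρ μW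
          (piSBReindex (↥(maximalRealSubfield L)) e₁ (piSchwartzBruhatEquiv (↥(maximalRealSubfield L)) (Fin N × Fin 1) (φ ⊗ₜ[ℂ] Φf))) f ν 2) := by
  rw [toLp_lineThetaLift_congr L N H e₁ dV hdV hdV0 ιA hιA μ hμ a hρ μW f ν
    (show piSBReindex (↥(maximalRealSubfield L)) e₁ (piSchwartzBruhatEquiv (↥(maximalRealSubfield L)) (Fin N × Fin 1) (φ ⊗ₜ[ℂ] (c • Φf))) =
        c • piSBReindex (↥(maximalRealSubfield L)) e₁ (piSchwartzBruhatEquiv (↥(maximalRealSubfield L)) (Fin N × Fin 1) (φ ⊗ₜ[ℂ] Φf)) by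
      rw [TensorProduct.tmul_smul, map_smul, map_smul])]
  exact toLp_lineThetaLift_smul_left L N H e₁ dV hdV hdV0 ιA hιA μ hμ a hρ μW f ν c _

variable [BorelSpace (↥(UnitaryGroup.adelic (↥(maximalRealSubfield L)) L (IsCMField.complexConj L) 1 (JW (↥(maximalRealSubfield L)) L a)) ⧸ (UnitaryGroup.toAdelic (↥(maximalRealSubfield L)) L (IsCMField.complexConj L) 1 (JW (↥(maximalRealSubfield L)) L a)).range)] [IsFiniteMeasure μW]

/-- **Additivity in the finite factor**: `[Θ̃_{R_e E(Φ_∞ ⊗ (Φ_f + Φ_f'))}(f) ∘ ιA] = [Θ̃_{R_e E(Φ_∞ ⊗ Φ_f)}(f) ∘ ιA] + [Θ̃_{R_e E(Φ_∞ ⊗ Φ_f')}(f) ∘ ιA]`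
(bilinearity of `⊗` + ★ `toLp_lineThetaLift_add_left`). [cite: Weil1964, Chap. III n° 41 Thm 6 p. 193] -/
theorem toLp_lineThetaLift_tensor_add (Φf Φf' : FinSB (↥(maximalRealSubfield L)) (Fin N × Fin 1)) :
    MemLp.toLp _ (memLp_toQuotFun_lineThetaLift L N H e₁ dV hdV hdV0 ιA hιA μ hμ a hρ μW
        (piSBReindex (↥(maximalRealSubfield L)) e₁ (piSchwartzBruhatEquiv (↥(maximalRealSubfield L)) (Fin N × Fin 1) (φ ⊗ₜ[ℂ] (Φf + Φf')))) f ν 2) =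
      MemLp.toLp _ (memLp_toQuotFun_lineThetaLift L N H e₁ dV hdV hdV0 ιA hιA μ hμ a hρ μW
          (piSBReindex (↥(maximalRealSubfield L)) e₁ (piSchwartzBruhatEquiv (↥(maximalRealSubfield L)) (Fin N × Fin 1) (φ ⊗ₜ[ℂ] Φf))) f ν 2) +
        MemLp.toLp _ (memLp_toQuotFun_lineThetaLift L N H e₁ dV hdV hdV0 ιA hιA μ hμ a hρ μW
          (piSBReindex (↥(maximalRealSubfield L)) e₁ (piSchwartzBruhatEquiv (↥(maximalRealSubfield L)) (Fin N × Fin 1) (φ ⊗ₜ[ℂ] Φf'))) f ν 2) := by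
  rw [toLp_lineThetaLift_congr L N H e₁ dV hdV hdV0 ιA hιA μ hμ a hρ μW f ν
    (show piSBReindex (↥(maximalRealSubfield L)) e₁ (piSchwartzBruhatEquiv (↥(maximalRealSubfield L)) (Fin N × Fin 1) (φ ⊗ₜ[ℂ] (Φf + Φf'))) =
        piSBReindex (↥(maximalRealSubfield L)) e₁ (piSchwartzBruhatEquiv (↥(maximalRealSubfield L)) (Fin N × Fin 1) (φ ⊗ₜ[ℂ] Φf)) +
          piSBReindex (↥(maximalRealSubfield L)) e₁ (piSchwartzBruhatEquiv (↥(maximalRealSubfield L)) (Fin N × Fin 1) (φ ⊗ₜ[ℂ] Φf')) by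
      rw [TensorProduct.tmul_add, map_add, map_add])]
  exact toLp_lineThetaLift_add_left L N H e₁ dV hdV hdV0 ιA hιA μ hμ a hρ μW f ν _ _

variable [SMulInvariantMeasure (adelicGroupData (↥(maximalRealSubfield L)) L (IsCMField.complexConj L) N H).Adelic (adelicGroupData (↥(maximalRealSubfield L)) L (IsCMField.complexConj L) N H).automorphicQuotient ν]

/-- **`U(H)(𝔸_{L⁺,f})`-EQUIVARIANCE in the finite factor**: `R((1,k)) [Θ̃_{R_e E(Φ_∞ ⊗ Φ_f)}(f) ∘ ιA] = [Θ̃_{R_e E(Φ_∞ ⊗ ω_f(ιV k, 1) Φ_f)}(f) ∘ ιA]`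
for the canonical finite transport `ιV k = (g_𝔸⁻¹ (1,k) g_𝔸)_f` (★ `rightRegular_toLp_lineThetaLift` at `(1, k)`; `ιA (1,k) = (1, ιV k)`; the `arch ⊗ fin`
factorisation ★ `pairRep_finPairToAdelic_piSBReindex_tmul` of the Weil representation at finite-adelic pair points).
[cite: BorelJacquet1979, §4.6] [cite: Weil1964, Chap. III n° 37–38 p. 188–190] -/
theorem rightRegular_finAdelicToAdelic_toLp_lineThetaLift_tensor
    (hιAf : ∀ k, ιA (finAdelicToAdelic (↥(maximalRealSubfield L)) L (IsCMField.complexConj L) N H k) =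
      finAdelicToAdelic (↥(maximalRealSubfield L)) L (IsCMField.complexConj L) N (Matrix.diagonal dV)
        (finPart (↥(maximalRealSubfield L)) L (IsCMField.complexConj L) N (Matrix.diagonal dV)
          (ιA (finAdelicToAdelic (↥(maximalRealSubfield L)) L (IsCMField.complexConj L) N H k))))
    (k : finAdelic (↥(maximalRealSubfield L)) L (IsCMField.complexConj L) N H)
    (Φf : FinSB (↥(maximalRealSubfield L)) (Fin N × Fin 1)) :
    (adelicGroupData (↥(maximalRealSubfield L)) L (IsCMField.complexConj L) N H).rightRegular ν
        (finAdelicToAdelic (↥(maximalRealSubfield L)) L (IsCMField.complexConj L) N H k)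
        (MemLp.toLp _ (memLp_toQuotFun_lineThetaLift L N H e₁ dV hdV hdV0 ιA hιA μ hμ a hρ μW
          (piSBReindex (↥(maximalRealSubfield L)) e₁ (piSchwartzBruhatEquiv (↥(maximalRealSubfield L)) (Fin N × Fin 1) (φ ⊗ₜ[ℂ] Φf))) f ν 2)) =
      MemLp.toLp _ (memLp_toQuotFun_lineThetaLift L N H e₁ dV hdV hdV0 ιA hιA μ hμ a hρ μW
        (piSBReindex (↥(maximalRealSubfield L)) e₁ (piSchwartzBruhatEquiv (↥(maximalRealSubfield L)) (Fin N × Fin 1)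
          (φ ⊗ₜ[ℂ] finPairRep (↥(maximalRealSubfield L)) L (IsCMField.complexConj L) N 1 e₁ (Matrix.diagonal dV) (JW (↥(maximalRealSubfield L)) L a)
            (complexConj_imagUnit L) (imagUnit_ne_zero L) (imagUnit_mul_self L) (realDiagonal_isSymm L dV hdV) (isSymm_TW (↥(maximalRealSubfield L)) a)
            (isUnit_det_realDiagonal L dV hdV hdV0) (isUnit_det_TW (↥(maximalRealSubfield L)) a) (realDiagonal_map L dV hdV).symm
            (JW_eq (↥(maximalRealSubfield L)) L a)
            (isCompatible_chiSplittingLine L e₁ dV hdV hdV0 (toHeckeCharacter L μ) (isUnitary_toHeckeCharacter L μ)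
              ((isOscillatorChar_toHeckeCharacter_iff μ).mpr hμ) (TW (↥(maximalRealSubfield L)) a) (isSymm_TW (↥(maximalRealSubfield L)) a)
              (isUnit_det_TW (↥(maximalRealSubfield L)) a) (JW (↥(maximalRealSubfield L)) L a) (JW_eq (↥(maximalRealSubfield L)) L a))
            ((finPart (↥(maximalRealSubfield L)) L (IsCMField.complexConj L) N (Matrix.diagonal dV)
              (ιA (finAdelicToAdelic (↥(maximalRealSubfield L)) L (IsCMField.complexConj L) N H k))), 1) Φf))) f ν 2) := by
  rw [rightRegular_toLp_lineThetaLift L N H e₁ dV hdV hdV0 ιA hιA μ hμ a hρ μW _ f ν]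
  refine toLp_lineThetaLift_congr L N H e₁ dV hdV hdV0 ιA hιA μ hμ a hρ μW f ν ?_
  -- `(ιA (1,k), 1) = ((1, ιV k), (1, 1))` as an element of the adelic dual pair
  have hp : (ιA (finAdelicToAdelic (↥(maximalRealSubfield L)) L (IsCMField.complexConj L) N H k),
        (1 : ↥(UnitaryGroup.adelic (↥(maximalRealSubfield L)) L (IsCMField.complexConj L) 1 (JW (↥(maximalRealSubfield L)) L a)))) =
      finPairToAdelic (↥(maximalRealSubfield L)) L (IsCMField.complexConj L) N 1 (Matrix.diagonal dV) (JW (↥(maximalRealSubfield L)) L a)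
        ((finPart (↥(maximalRealSubfield L)) L (IsCMField.complexConj L) N (Matrix.diagonal dV)
          (ιA (finAdelicToAdelic (↥(maximalRealSubfield L)) L (IsCMField.complexConj L) N H k))), 1) :=
    Prod.ext (hιAf k)
      (by rw [finPairToAdelic_apply, map_one]; rfl)
  rw [hp]
  exact pairRep_finPairToAdelic_piSBReindex_tmul (↥(maximalRealSubfield L)) L (IsCMField.complexConj L) N 1 e₁ (Matrix.diagonal dV)
    (JW (↥(maximalRealSubfield L)) L a) (complexConj_imagUnit L) (imagUnit_ne_zero L) (imagUnit_mul_self L) (realDiagonal_isSymm L dV hdV)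
    (isSymm_TW (↥(maximalRealSubfield L)) a) (isUnit_det_realDiagonal L dV hdV hdV0) (isUnit_det_TW (↥(maximalRealSubfield L)) a)
    (realDiagonal_map L dV hdV).symm (JW_eq (↥(maximalRealSubfield L)) L a) _ _ φ Φf


variable [SMulInvariantMeasure ↥(UnitaryGroup.adelic (↥(maximalRealSubfield L)) L (IsCMField.complexConj L) 1 (JW (↥(maximalRealSubfield L)) L a)) (↥(UnitaryGroup.adelic (↥(maximalRealSubfield L)) L (IsCMField.complexConj L) 1 (JW (↥(maximalRealSubfield L)) L a)) ⧸ (UnitaryGroup.toAdelic (↥(maximalRealSubfield L)) L (IsCMField.complexConj L) 1 (JW (↥(maximalRealSubfield L)) L a)).range) μW]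

omit [SMulInvariantMeasure (adelicGroupData (↥(maximalRealSubfield L)) L (IsCMField.complexConj L) N H).Adelic (adelicGroupData (↥(maximalRealSubfield L)) L (IsCMField.complexConj L) N H).automorphicQuotient ν] in
/-- **`χ_W`-COVARIANCE in the finite factor**: `[Θ̃_{R_e E(Φ_∞ ⊗ ω_f(1,u)Φ_f)}(charCM χ̃) ∘ ιA] = χ_W(u) • [Θ̃_{R_e E(Φ_∞ ⊗ Φ_f)}(charCM χ̃) ∘ ιA]` for
`u ∈ U(⟨a⟩)(𝔸_{L⁺,f})`, `χ̃ = chiQuot a χ` (trivial at `∞`, finite part `χ_W = lineChar a χ`): ★ `toLp_lineThetaLift_pairRep_one_charCM` at `h = (1, u)`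
and ★ `coe_chiQuot_mk_finAdelicToAdelic` — the map `Φ_f ↦ [Θ̃_{R_e E(Φ_∞ ⊗ Φ_f)}(charCM χ̃) ∘ ιA]` kills the relation module of the `χ_W`-coinvariants
`omegaAtLine … a χ`. [cite: Liu2021, App. D §D.1 Step 3 (l. 5221)] [cite: GelbartRogawski1991, §3.2 p. 457] -/
theorem toLp_lineThetaLift_tensor_finPairRep_one (χ : Chi (↥(maximalRealSubfield L)) L (IsCMField.complexConj L))
    (u : finAdelic (↥(maximalRealSubfield L)) L (IsCMField.complexConj L) 1 (JW (↥(maximalRealSubfield L)) L a))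
    (Φf : FinSB (↥(maximalRealSubfield L)) (Fin N × Fin 1)) :
    haveI := normal_range_toAdelic_JW L a
    MemLp.toLp _ (memLp_toQuotFun_lineThetaLift L N H e₁ dV hdV hdV0 ιA hιA μ hμ a hρ μW
        (piSBReindex (↥(maximalRealSubfield L)) e₁ (piSchwartzBruhatEquiv (↥(maximalRealSubfield L)) (Fin N × Fin 1)
          (φ ⊗ₜ[ℂ] finPairRep (↥(maximalRealSubfield L)) L (IsCMField.complexConj L) N 1 e₁ (Matrix.diagonal dV) (JW (↥(maximalRealSubfield L)) L a)
            (complexConj_imagUnit L) (imagUnit_ne_zero L) (imagUnit_mul_self L) (realDiagonal_isSymm L dV hdV) (isSymm_TW (↥(maximalRealSubfield L)) a)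
            (isUnit_det_realDiagonal L dV hdV hdV0) (isUnit_det_TW (↥(maximalRealSubfield L)) a) (realDiagonal_map L dV hdV).symm
            (JW_eq (↥(maximalRealSubfield L)) L a)
            (isCompatible_chiSplittingLine L e₁ dV hdV hdV0 (toHeckeCharacter L μ) (isUnitary_toHeckeCharacter L μ)
              ((isOscillatorChar_toHeckeCharacter_iff μ).mpr hμ) (TW (↥(maximalRealSubfield L)) a) (isSymm_TW (↥(maximalRealSubfield L)) a)
              (isUnit_det_TW (↥(maximalRealSubfield L)) a) (JW (↥(maximalRealSubfield L)) L a) (JW_eq (↥(maximalRealSubfield L)) L a))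
            (1, u) Φf)))
        (charCM (chiQuot (↥(maximalRealSubfield L)) L (IsCMField.complexConj L) (Algebra.IsQuadraticExtension.finrank_eq_two _ L)
          (IsCMField.complexConj_ne_one (K := L)) a χ)) ν 2) =
      ((lineChar (↥(maximalRealSubfield L)) L (IsCMField.complexConj L) a χ.1 u : ℂˣ) : ℂ) •
        MemLp.toLp _ (memLp_toQuotFun_lineThetaLift L N H e₁ dV hdV hdV0 ιA hιA μ hμ a hρ μW
          (piSBReindex (↥(maximalRealSubfield L)) e₁ (piSchwartzBruhatEquiv (↥(maximalRealSubfield L)) (Fin N × Fin 1) (φ ⊗ₜ[ℂ] Φf)))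
          (charCM (chiQuot (↥(maximalRealSubfield L)) L (IsCMField.complexConj L) (Algebra.IsQuadraticExtension.finrank_eq_two _ L)
            (IsCMField.complexConj_ne_one (K := L)) a χ)) ν 2) := by
  haveI := normal_range_toAdelic_JW L a
  -- `((1,1), (1,u)) = finPairToAdelic (1, u)` in the adelic dual pair
  have hp : ((1, finAdelicToAdelic (↥(maximalRealSubfield L)) L (IsCMField.complexConj L) 1 (JW (↥(maximalRealSubfield L)) L a) u) :
        ↥(UnitaryGroup.adelic (↥(maximalRealSubfield L)) L (IsCMField.complexConj L) N (Matrix.diagonal dV)) ×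
          ↥(UnitaryGroup.adelic (↥(maximalRealSubfield L)) L (IsCMField.complexConj L) 1 (JW (↥(maximalRealSubfield L)) L a))) =
      finPairToAdelic (↥(maximalRealSubfield L)) L (IsCMField.complexConj L) N 1 (Matrix.diagonal dV) (JW (↥(maximalRealSubfield L)) L a) (1, u) := by
    simp only [finPairToAdelic_apply, map_one]
    rfl
  rw [toLp_lineThetaLift_congr L N H e₁ dV hdV hdV0 ιA hιA μ hμ a hρ μW _ ν
    (show piSBReindex (↥(maximalRealSubfield L)) e₁ (piSchwartzBruhatEquiv (↥(maximalRealSubfield L)) (Fin N × Fin 1)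
          (φ ⊗ₜ[ℂ] finPairRep (↥(maximalRealSubfield L)) L (IsCMField.complexConj L) N 1 e₁ (Matrix.diagonal dV) (JW (↥(maximalRealSubfield L)) L a)
            (complexConj_imagUnit L) (imagUnit_ne_zero L) (imagUnit_mul_self L) (realDiagonal_isSymm L dV hdV) (isSymm_TW (↥(maximalRealSubfield L)) a)
            (isUnit_det_realDiagonal L dV hdV hdV0) (isUnit_det_TW (↥(maximalRealSubfield L)) a) (realDiagonal_map L dV hdV).symm
            (JW_eq (↥(maximalRealSubfield L)) L a)
            (isCompatible_chiSplittingLine L e₁ dV hdV hdV0 (toHeckeCharacter L μ) (isUnitary_toHeckeCharacter L μ)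
              ((isOscillatorChar_toHeckeCharacter_iff μ).mpr hμ) (TW (↥(maximalRealSubfield L)) a) (isSymm_TW (↥(maximalRealSubfield L)) a)
              (isUnit_det_TW (↥(maximalRealSubfield L)) a) (JW (↥(maximalRealSubfield L)) L a) (JW_eq (↥(maximalRealSubfield L)) L a))
            (1, u) Φf)) =
        pairRep (↥(maximalRealSubfield L)) L (IsCMField.complexConj L) N 1 e₁ (Matrix.diagonal dV) (JW (↥(maximalRealSubfield L)) L a)
          (chiSplittingLine L e₁ dV hdV hdV0 (toHeckeCharacter L μ) (isUnitary_toHeckeCharacter L μ)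
            ((isOscillatorChar_toHeckeCharacter_iff μ).mpr hμ) (TW (↥(maximalRealSubfield L)) a)
            (isUnit_det_TW (↥(maximalRealSubfield L)) a) (JW (↥(maximalRealSubfield L)) L a) (JW_eq (↥(maximalRealSubfield L)) L a))
          ((1, finAdelicToAdelic (↥(maximalRealSubfield L)) L (IsCMField.complexConj L) 1 (JW (↥(maximalRealSubfield L)) L a) u) :
            ↥(UnitaryGroup.adelic (↥(maximalRealSubfield L)) L (IsCMField.complexConj L) N (Matrix.diagonal dV)) ×
              ↥(UnitaryGroup.adelic (↥(maximalRealSubfield L)) L (IsCMField.complexConj L) 1 (JW (↥(maximalRealSubfield L)) L a)))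
          (piSBReindex (↥(maximalRealSubfield L)) e₁ (piSchwartzBruhatEquiv (↥(maximalRealSubfield L)) (Fin N × Fin 1) (φ ⊗ₜ[ℂ] Φf))) by
      rw [hp]
      exact (pairRep_finPairToAdelic_piSBReindex_tmul (↥(maximalRealSubfield L)) L (IsCMField.complexConj L) N 1 e₁ (Matrix.diagonal dV)
        (JW (↥(maximalRealSubfield L)) L a) (complexConj_imagUnit L) (imagUnit_ne_zero L) (imagUnit_mul_self L) (realDiagonal_isSymm L dV hdV)
        (isSymm_TW (↥(maximalRealSubfield L)) a) (isUnit_det_realDiagonal L dV hdV hdV0) (isUnit_det_TW (↥(maximalRealSubfield L)) a)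
        (realDiagonal_map L dV hdV).symm (JW_eq (↥(maximalRealSubfield L)) L a) _ _ φ Φf).symm)]
  rw [toLp_lineThetaLift_pairRep_one_charCM L N H e₁ dV hdV hdV0 ιA hιA μ hμ a hρ μW _ ν
    (finAdelicToAdelic (↥(maximalRealSubfield L)) L (IsCMField.complexConj L) 1 (JW (↥(maximalRealSubfield L)) L a) u)
    (chiQuot (↥(maximalRealSubfield L)) L (IsCMField.complexConj L) (Algebra.IsQuadraticExtension.finrank_eq_two _ L)
      (IsCMField.complexConj_ne_one (K := L)) a χ),
    coe_chiQuot_mk_finAdelicToAdelic]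

end Tensor

end Summit.HodgeConjecture.HodgeConjecture.Cruxes.HLiu418.F0LD2ThetaTensorClasses

end
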